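import Summits.QuantumFields.BalabanUV.Beta.FP.KktCombRowShear

/-!
# `BalabanUV.Beta.FP.KktCombRowShearConverse` — road «FP» (binder row D1): **THE CONVERSE OF THE COMB-ROW SHEAR** — if two doubly bordered KKT matrices
# `kkt H [Q₁; P]`, `kkt H [Q₂; P]` (same form `H`, same second row block `P`) have right inverses with THE SAME `(field ⊕ Q-slot)` LEG and the leg's
# `(Q-slot, Q-slot)` block is invertible, then `Q₁ = Q₂ + Y·P` for an explicit `Y` (road CORR-1 (2) ∕ an2 A-4 (2), hand-checked there; typed here)

WHY (located).  With `KktCombRowShear` (forward: a comb shear `Y·P` of the first row block carries right inverses and leaves the leg unchanged) this closes the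
equivalence «v10's `hXN ∧ hLN` ⟺ `hQN′`» IN THE KERNEL: v10's N-leg letter pairs the (0.4)-SYM nested rows `𝔔₀` with the leg that leaf-05 + leaf-02 PROVE for the
ROOTED composite rows `(sn n)•𝔔♭`; by this file the two are compatible only if `𝔔₀ − (sn n)•𝔔♭` lies in the span of the comb-indicator rows `P`.  So Engine C's
ASK-2′ («does `Δ` vanish off the comb?») decides v10's `hLN` by value with a THEOREM on each side, not a reading.

WHAT ([folklore] block algebra over `ℝ`; no `def`, nothing cited, 0 sorry): §1 block rows of `kkt H [Q;P]·Z = 1`: `kkt_mul_eq_one_block₁₂` (`H·Z[f,s] + [Q;P]ᵀ·Z[s,s] = 0` on the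
`(f, Q⊕P)` block), `transpose_fromRows_mul_fromRows` and **`kkt_row_identity`**: `H·Z.sub inl (inr∘inl) + Qᵀ·Z.sub (inr∘inl) (inr∘inl) + Pᵀ·Z.sub (inr∘inr) (inr∘inl) = 0`;
§2 **`rows_eq_add_mul_of_shared_leg`**: from `kkt H [Qᵢ; P]·Zᵢ = 1` (i = 1, 2), `Z₁.sub inl (inr∘inl) = Z₂.sub inl (inr∘inl)`, `Z₁.sub (inr∘inl) (inr∘inl) = Z₂.sub (inr∘inl) (inr∘inl) =: T`
with `T` invertible: `Q₁ = Q₂ + Y·P`, `Y := −(T⁻¹)ᵀ·(Z₁.sub (inr∘inr) (inr∘inl) − Z₂.sub (inr∘inr) (inr∘inl))ᵀ`; §3 `…_of_leg_eq`: the same with the hypotheses read off ONE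
equation of legs `Z₁.submatrix (Sum.map id inl) (Sum.map id inl) = Z₂.submatrix (Sum.map id inl) (Sum.map id inl)`.

WHAT THIS IS NOT: generic algebra; no table of Bałaban's touched; nothing asserted, valued or discharged; 0 estimates; 0∕4 row-D1 binders (hW, hR, D1Tel, D1Rep); NOT (C1),
NOT (T-ID), NOT D1, NEVER «G-an2-4 closed», NOT BetaPertH, NOT continuum, NOT Clay.

HONEST DEPENDENCY (page 1, mandatory): continuum YM on T⁴ ⇐ BetaPertH ∧ nine spine estimates (0/9 proved); BetaPertH ⇐ (D1) ∧ (D4) ∧ CAP+tail;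
G-an2-4 gates asym, D1 and NE2/3/4.  HONEST FRAMING (cell contract, verbatim): «discharging `BetaPertH` makes Bałaban's UV stability UNCONDITIONAL —
a real constructive-QFT result; it is NOT the continuum limit and NOT the Clay problem.»  ABSOLUTE RULE (cell charter, verbatim): «No internally-minted
statement may enter as a cited fact. Every hypothesis is either kernel-proved in this package or a verbatim quotation of a PUBLISHED theorem with page
reference. The manuscript(s) under audit are NOT citable for their own disputed steps — they are the thing under adjudication; programme-internal
(2001/route/tribunal) claims are never citable.»  Road «FP» OWNER, b2b-balaban-beta-d1-p3 gen 57, 2026-08-29.  No existing file touched.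
-/

noncomputable section

open scoped BigOperators Matrix

namespace Summit.QuantumFields.BalabanUV.Beta.FP.KktCombRowShearConverse

open Matrix
open Literature.MathematicalPhysics.QuantumFieldTheory.Balaban1983to89.Beta.Composition (kkt)

variable {ν κ ρ : Type*} [Fintype ν] [Fintype κ] [Fintype ρ] [DecidableEq ν] [DecidableEq κ] [DecidableEq ρ]

/-! ## §1 The `(field, slot)` block row of `kkt H [Q;P]·Z = 1` -/

omit [DecidableEq ν] [DecidableEq κ] [DecidableEq ρ] in
/-- [folklore] the `(f, Q⊕P)` block of `kkt H R·Z` where `Z = fromBlocks Z₁₁ Z₁₂ Z₂₁ Z₂₂`: `H·Z₁₂ + Rᵀ·Z₂₂`. -/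
theorem kkt_mul_fromBlocks_toBlocks₁₂ (H : Matrix ν ν ℝ) (R : Matrix (κ ⊕ ρ) ν ℝ)
    (Z₁₁ : Matrix ν ν ℝ) (Z₁₂ : Matrix ν (κ ⊕ ρ) ℝ) (Z₂₁ : Matrix (κ ⊕ ρ) ν ℝ) (Z₂₂ : Matrix (κ ⊕ ρ) (κ ⊕ ρ) ℝ) :
    (kkt H R * fromBlocks Z₁₁ Z₁₂ Z₂₁ Z₂₂).toBlocks₁₂ = H * Z₁₂ + Rᵀ * Z₂₂ := by
  unfold kkt
  rw [fromBlocks_multiply, toBlocks_fromBlocks₁₂]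

/-- [folklore] **THE `(f, Q⊕P)` BLOCK ROW OF A RIGHT INVERSE**: `kkt H R·Z = 1 ⟹ H·Z.toBlocks₁₂ + Rᵀ·Z.toBlocks₂₂ = 0`. -/
theorem kkt_mul_eq_one_block₁₂ (H : Matrix ν ν ℝ) (R : Matrix (κ ⊕ ρ) ν ℝ) (Z : Matrix (ν ⊕ (κ ⊕ ρ)) (ν ⊕ (κ ⊕ ρ)) ℝ)
    (hZ : kkt H R * Z = 1) : H * Z.toBlocks₁₂ + Rᵀ * Z.toBlocks₂₂ = 0 := by
  have h := congrArg Matrix.toBlocks₁₂ hZ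
  rw [← fromBlocks_toBlocks Z, kkt_mul_fromBlocks_toBlocks₁₂] at h
  rw [h, ← fromBlocks_one, toBlocks_fromBlocks₁₂]

omit [Fintype ν] [DecidableEq ν] [DecidableEq κ] [DecidableEq ρ] in
/-- [folklore] `[Q;P]ᵀ·W` in submatrix spelling: `(fromRows Q P)ᵀ * W = Qᵀ * W.submatrix inl id + Pᵀ * W.submatrix inr id`. -/
theorem transpose_fromRows_mul (Q : Matrix κ ν ℝ) (P : Matrix ρ ν ℝ) {σ : Type*} (W : Matrix (κ ⊕ ρ) σ ℝ) :
    (fromRows Q P)ᵀ * W = Qᵀ * W.submatrix Sum.inl id + Pᵀ * W.submatrix Sum.inr id := by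
  rw [transpose_fromRows, ← fromRows_toRows W, fromCols_mul_fromRows]
  rfl

/-- [folklore] restricting the block row to the `Q`-slot columns: **`H·Z[f,s] + Qᵀ·Z[s,s] + Pᵀ·Z[P,s] = 0`** with `Z[f,s] := Z.submatrix inl (inr∘inl)`,
`Z[s,s] := Z.submatrix (inr∘inl) (inr∘inl)`, `Z[P,s] := Z.submatrix (inr∘inr) (inr∘inl)`. -/
theorem kkt_row_identity (H : Matrix ν ν ℝ) (Q : Matrix κ ν ℝ) (P : Matrix ρ ν ℝ) (Z : Matrix (ν ⊕ (κ ⊕ ρ)) (ν ⊕ (κ ⊕ ρ)) ℝ)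
    (hZ : kkt H (fromRows Q P) * Z = 1) :
    H * Z.submatrix Sum.inl (Sum.inr ∘ Sum.inl) + Qᵀ * Z.submatrix (Sum.inr ∘ Sum.inl) (Sum.inr ∘ Sum.inl)
        + Pᵀ * Z.submatrix (Sum.inr ∘ Sum.inr) (Sum.inr ∘ Sum.inl) = 0 := by
  have h := kkt_mul_eq_one_block₁₂ H (fromRows Q P) Z hZ
  have h' : (H * Z.toBlocks₁₂).submatrix id Sum.inl + ((fromRows Q P)ᵀ * Z.toBlocks₂₂).submatrix id Sum.inl = 0 :=
    congrArg (fun M : Matrix ν (κ ⊕ ρ) ℝ => M.submatrix id Sum.inl) h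
  rw [Matrix.submatrix_mul _ _ id id Sum.inl Function.bijective_id, Matrix.submatrix_mul _ _ id id Sum.inl Function.bijective_id,
    Matrix.submatrix_id_id, Matrix.submatrix_id_id, transpose_fromRows_mul] at h'
  rw [← h', add_assoc]
  rfl

/-! ## §2 The converse: a shared leg with invertible slot block forces the rows to differ by a comb shear -/

/-- [folklore] **ROWS DIFFER BY A SHEAR OF THE SECOND BLOCK**: two right inverses of `kkt H [Qᵢ; P]` sharing the `(f,s)` and `(s,s)` blocks, the latter invertible ⟹
`Q₁ = Q₂ + Y·P` with `Y := −(T⁻¹)ᵀ·(Z₁[P,s] − Z₂[P,s])ᵀ`. -/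
theorem rows_eq_add_mul_of_shared_blocks (H : Matrix ν ν ℝ) (Q₁ Q₂ : Matrix κ ν ℝ) (P : Matrix ρ ν ℝ)
    (Z₁ Z₂ : Matrix (ν ⊕ (κ ⊕ ρ)) (ν ⊕ (κ ⊕ ρ)) ℝ) (hZ₁ : kkt H (fromRows Q₁ P) * Z₁ = 1) (hZ₂ : kkt H (fromRows Q₂ P) * Z₂ = 1)
    (hfs : Z₁.submatrix Sum.inl (Sum.inr ∘ Sum.inl) = Z₂.submatrix Sum.inl (Sum.inr ∘ Sum.inl))
    {T : Matrix κ κ ℝ} (hT₁ : Z₁.submatrix (Sum.inr ∘ Sum.inl) (Sum.inr ∘ Sum.inl) = T) (hT₂ : Z₂.submatrix (Sum.inr ∘ Sum.inl) (Sum.inr ∘ Sum.inl) = T)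
    (hT : IsUnit T.det) :
    Q₁ = Q₂ + (-((T⁻¹)ᵀ * (Z₁.submatrix (Sum.inr ∘ Sum.inr) (Sum.inr ∘ Sum.inl) - Z₂.submatrix (Sum.inr ∘ Sum.inr) (Sum.inr ∘ Sum.inl))ᵀ)) * P := by
  have h₁ := kkt_row_identity H Q₁ P Z₁ hZ₁
  have h₂ := kkt_row_identity H Q₂ P Z₂ hZ₂
  rw [hfs, hT₁] at h₁
  rw [hT₂] at h₂
  -- subtract: (Q₁ − Q₂)ᵀ·T = −Pᵀ·(Z₁[P,s] − Z₂[P,s])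
  have hd : (Q₁ - Q₂)ᵀ * T = -(Pᵀ * (Z₁.submatrix (Sum.inr ∘ Sum.inr) (Sum.inr ∘ Sum.inl) - Z₂.submatrix (Sum.inr ∘ Sum.inr) (Sum.inr ∘ Sum.inl))) := by
    have e : (H * Z₂.submatrix Sum.inl (Sum.inr ∘ Sum.inl) + Q₁ᵀ * T + Pᵀ * Z₁.submatrix (Sum.inr ∘ Sum.inr) (Sum.inr ∘ Sum.inl))
        - (H * Z₂.submatrix Sum.inl (Sum.inr ∘ Sum.inl) + Q₂ᵀ * T + Pᵀ * Z₂.submatrix (Sum.inr ∘ Sum.inr) (Sum.inr ∘ Sum.inl)) = 0 := by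
      rw [h₁, h₂, sub_zero]
    rw [transpose_sub, Matrix.sub_mul, Matrix.mul_sub, eq_neg_iff_add_eq_zero, ← e]
    abel
  -- solve for Q₁ᵀ: multiply by T⁻¹ on the right
  have hTinv : T * T⁻¹ = 1 := Matrix.mul_nonsing_inv T hT
  have hd' : (Q₁ - Q₂)ᵀ = -(Pᵀ * (Z₁.submatrix (Sum.inr ∘ Sum.inr) (Sum.inr ∘ Sum.inl) - Z₂.submatrix (Sum.inr ∘ Sum.inr) (Sum.inr ∘ Sum.inl))) * T⁻¹ := by
    rw [← hd, Matrix.mul_assoc, hTinv, Matrix.mul_one]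
  have hd'' := congrArg Matrix.transpose hd'
  rw [transpose_transpose, transpose_mul, transpose_neg, transpose_mul, transpose_transpose] at hd''
  rw [← sub_eq_iff_eq_add', hd'', Matrix.mul_neg, Matrix.neg_mul, Matrix.mul_assoc]

/-! ## §3 The same with the hypotheses read off ONE equation of legs (v10's `hLN` shape: `Z.submatrix (Sum.map id inl) (Sum.map id inl) = fromBlocks Γ I L S'`) -/

omit [Fintype ν] [Fintype κ] [Fintype ρ] [DecidableEq ν] [DecidableEq κ] [DecidableEq ρ] in
/-- [folklore] the `(f, s)` block of the leg is `Z.submatrix inl (inr∘inl)`. -/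
theorem leg_toBlocks₁₂ (Z : Matrix (ν ⊕ (κ ⊕ ρ)) (ν ⊕ (κ ⊕ ρ)) ℝ) :
    (Z.submatrix (Sum.map id Sum.inl) (Sum.map id Sum.inl)).toBlocks₁₂ = Z.submatrix Sum.inl (Sum.inr ∘ Sum.inl) := by
  ext i j; rfl

omit [Fintype ν] [Fintype κ] [Fintype ρ] [DecidableEq ν] [DecidableEq κ] [DecidableEq ρ] in
/-- [folklore] the `(s, s)` block of the leg is `Z.submatrix (inr∘inl) (inr∘inl)`. -/
theorem leg_toBlocks₂₂ (Z : Matrix (ν ⊕ (κ ⊕ ρ)) (ν ⊕ (κ ⊕ ρ)) ℝ) :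
    (Z.submatrix (Sum.map id Sum.inl) (Sum.map id Sum.inl)).toBlocks₂₂ = Z.submatrix (Sum.inr ∘ Sum.inl) (Sum.inr ∘ Sum.inl) := by
  ext i j; rfl

/-- [folklore] **THE CONVERSE IN v10's SHAPE**: if `kkt H [Qᵢ; P]·Zᵢ = 1` (i = 1,2) and both legs display the SAME four blocks `fromBlocks Γ I L S'` with `S'` of invertible
determinant, then `∃ Y, Q₁ = Q₂ + Y·P`. -/
theorem rows_eq_add_mul_of_leg_eq (H : Matrix ν ν ℝ) (Q₁ Q₂ : Matrix κ ν ℝ) (P : Matrix ρ ν ℝ)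
    (Z₁ Z₂ : Matrix (ν ⊕ (κ ⊕ ρ)) (ν ⊕ (κ ⊕ ρ)) ℝ) (hZ₁ : kkt H (fromRows Q₁ P) * Z₁ = 1) (hZ₂ : kkt H (fromRows Q₂ P) * Z₂ = 1)
    {Γ : Matrix ν ν ℝ} {I : Matrix ν κ ℝ} {L : Matrix κ ν ℝ} {S' : Matrix κ κ ℝ}
    (hL₁ : Z₁.submatrix (Sum.map id Sum.inl) (Sum.map id Sum.inl) = fromBlocks Γ I L S')
    (hL₂ : Z₂.submatrix (Sum.map id Sum.inl) (Sum.map id Sum.inl) = fromBlocks Γ I L S') (hS : IsUnit S'.det) :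
    ∃ Y : Matrix κ ρ ℝ, Q₁ = Q₂ + Y * P := by
  have h12₁ := leg_toBlocks₁₂ Z₁; rw [hL₁, toBlocks_fromBlocks₁₂] at h12₁
  have h12₂ := leg_toBlocks₁₂ Z₂; rw [hL₂, toBlocks_fromBlocks₁₂] at h12₂
  have h22₁ := leg_toBlocks₂₂ Z₁; rw [hL₁, toBlocks_fromBlocks₂₂] at h22₁
  have h22₂ := leg_toBlocks₂₂ Z₂; rw [hL₂, toBlocks_fromBlocks₂₂] at h22₂
  exact ⟨_, rows_eq_add_mul_of_shared_blocks H Q₁ Q₂ P Z₁ Z₂ hZ₁ hZ₂ (h12₁.symm.trans h12₂) h22₁.symm h22₂.symm hS⟩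

/-! ## §4 (v2) The converse WITHOUT the slot-block non-degeneracy: two-sided inverses, shared `(f,f)` and `(f,s)` blocks (road CORR-2) -/

omit [DecidableEq ν] [DecidableEq κ] [DecidableEq ρ] in
/-- [folklore] the `(f,f)` block of `Z·kkt H R` where `Z = fromBlocks Z₁₁ Z₁₂ Z₂₁ Z₂₂`: `Z₁₁·H + Z₁₂·R`. -/
theorem fromBlocks_mul_kkt_toBlocks₁₁ (H : Matrix ν ν ℝ) (R : Matrix (κ ⊕ ρ) ν ℝ)
    (Z₁₁ : Matrix ν ν ℝ) (Z₁₂ : Matrix ν (κ ⊕ ρ) ℝ) (Z₂₁ : Matrix (κ ⊕ ρ) ν ℝ) (Z₂₂ : Matrix (κ ⊕ ρ) (κ ⊕ ρ) ℝ) :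
    (fromBlocks Z₁₁ Z₁₂ Z₂₁ Z₂₂ * kkt H R).toBlocks₁₁ = Z₁₁ * H + Z₁₂ * R := by
  unfold kkt
  rw [fromBlocks_multiply, toBlocks_fromBlocks₁₁]

omit [DecidableEq ν] [DecidableEq κ] [DecidableEq ρ] in
/-- [folklore] the `(Q⊕P, Q⊕P)` block of `kkt H R·Z`: `R·Z₁₂` (the zero corner contributes nothing). -/
theorem kkt_mul_fromBlocks_toBlocks₂₂ (H : Matrix ν ν ℝ) (R : Matrix (κ ⊕ ρ) ν ℝ)
    (Z₁₁ : Matrix ν ν ℝ) (Z₁₂ : Matrix ν (κ ⊕ ρ) ℝ) (Z₂₁ : Matrix (κ ⊕ ρ) ν ℝ) (Z₂₂ : Matrix (κ ⊕ ρ) (κ ⊕ ρ) ℝ) :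
    (kkt H R * fromBlocks Z₁₁ Z₁₂ Z₂₁ Z₂₂).toBlocks₂₂ = R * Z₁₂ := by
  unfold kkt
  rw [fromBlocks_multiply, toBlocks_fromBlocks₂₂, Matrix.zero_mul, add_zero]

omit [Fintype ν] [DecidableEq ν] [DecidableEq κ] [DecidableEq ρ] in
/-- [folklore] `A·[Q;P] = A.sub id inl·Q + A.sub id inr·P`. -/
theorem mul_fromRows_split {σ : Type*} (A : Matrix σ (κ ⊕ ρ) ℝ) (Q : Matrix κ ν ℝ) (P : Matrix ρ ν ℝ) :
    A * fromRows Q P = A.submatrix id Sum.inl * Q + A.submatrix id Sum.inr * P := by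
  rw [← fromCols_toCols A, fromCols_mul_fromRows]
  rfl

/-- [folklore] **THE `(f,f)` BLOCK ROW OF THE TWO-SIDED INVERSE**: `kkt H [Q;P]·Z = 1 ⟹ Z[f,f]·H + Z[f,s]·Q + Z[f,P]·P = 1` (square matrices: `Z` is also a LEFT inverse,
`Matrix.mul_eq_one_comm`). -/
theorem kkt_ff_identity (H : Matrix ν ν ℝ) (Q : Matrix κ ν ℝ) (P : Matrix ρ ν ℝ) (Z : Matrix (ν ⊕ (κ ⊕ ρ)) (ν ⊕ (κ ⊕ ρ)) ℝ)
    (hZ : kkt H (fromRows Q P) * Z = 1) :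
    Z.submatrix Sum.inl Sum.inl * H + Z.submatrix Sum.inl (Sum.inr ∘ Sum.inl) * Q + Z.submatrix Sum.inl (Sum.inr ∘ Sum.inr) * P = 1 := by
  have hZ' : Z * kkt H (fromRows Q P) = 1 := mul_eq_one_comm.mp hZ
  have h := congrArg Matrix.toBlocks₁₁ hZ'
  rw [← fromBlocks_toBlocks Z, fromBlocks_mul_kkt_toBlocks₁₁, ← fromBlocks_one, toBlocks_fromBlocks₁₁, mul_fromRows_split, ← add_assoc] at h
  exact h

/-- [folklore] **THE ROWS ARE A LEFT INVERSE OF THE `(f,s)` BLOCK**: `kkt H [Q;P]·Z = 1 ⟹ Q·Z[f,s] = 1`. -/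
theorem rows_mul_fs_eq_one (H : Matrix ν ν ℝ) (Q : Matrix κ ν ℝ) (P : Matrix ρ ν ℝ) (Z : Matrix (ν ⊕ (κ ⊕ ρ)) (ν ⊕ (κ ⊕ ρ)) ℝ)
    (hZ : kkt H (fromRows Q P) * Z = 1) :
    Q * Z.submatrix Sum.inl (Sum.inr ∘ Sum.inl) = 1 := by
  have h := congrArg Matrix.toBlocks₂₂ hZ
  rw [← fromBlocks_toBlocks Z, kkt_mul_fromBlocks_toBlocks₂₂, ← fromBlocks_one, toBlocks_fromBlocks₂₂, fromRows_mul] at h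
  -- `h : fromRows (Q·Z₁₂) (P·Z₁₂) = 1`; read its `(inl, inl)` entries
  ext i j
  have hij := congrFun (congrFun h (Sum.inl i)) (Sum.inl j)
  rw [fromRows_apply_inl, Matrix.one_apply] at hij
  rw [Matrix.one_apply]
  simp only [Sum.inl.injEq] at hij
  exact hij

/-- [folklore] **THE CONVERSE WITHOUT `det S′ ≠ 0`** (road CORR-2): two right inverses of `kkt H [Qᵢ;P]` (square, hence two-sided) sharing the `(f,f)` block `Γ` and the `(f,s)` block `I`
⟹ `Q₁ = Q₂ + (Q₂·(J₂ − J₁))·P` with `Jᵢ := Zᵢ[f,P]` — from `Γ·H + I·Qᵢ + Jᵢ·P = 1` (both) and `Q₂·I = 1`.  No non-degeneracy of the slot block is needed. -/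
theorem rows_eq_add_mul_of_shared_ff_fs (H : Matrix ν ν ℝ) (Q₁ Q₂ : Matrix κ ν ℝ) (P : Matrix ρ ν ℝ)
    (Z₁ Z₂ : Matrix (ν ⊕ (κ ⊕ ρ)) (ν ⊕ (κ ⊕ ρ)) ℝ) (hZ₁ : kkt H (fromRows Q₁ P) * Z₁ = 1) (hZ₂ : kkt H (fromRows Q₂ P) * Z₂ = 1)
    (hff : Z₁.submatrix Sum.inl Sum.inl = Z₂.submatrix Sum.inl Sum.inl)
    (hfs : Z₁.submatrix Sum.inl (Sum.inr ∘ Sum.inl) = Z₂.submatrix Sum.inl (Sum.inr ∘ Sum.inl)) :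
    Q₁ = Q₂ + (Q₂ * (Z₂.submatrix Sum.inl (Sum.inr ∘ Sum.inr) - Z₁.submatrix Sum.inl (Sum.inr ∘ Sum.inr))) * P := by
  have h₁ := kkt_ff_identity H Q₁ P Z₁ hZ₁
  have h₂ := kkt_ff_identity H Q₂ P Z₂ hZ₂
  have hQI := rows_mul_fs_eq_one H Q₂ P Z₂ hZ₂
  rw [hff, hfs] at h₁
  -- `I·(Q₁ − Q₂) = (J₂ − J₁)·P`
  have hd : Z₂.submatrix Sum.inl (Sum.inr ∘ Sum.inl) * (Q₁ - Q₂)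
      = (Z₂.submatrix Sum.inl (Sum.inr ∘ Sum.inr) - Z₁.submatrix Sum.inl (Sum.inr ∘ Sum.inr)) * P := by
    have e := h₁.trans h₂.symm
    rw [add_assoc, add_assoc] at e
    have e2 := add_left_cancel e
    rw [Matrix.mul_sub, Matrix.sub_mul, sub_eq_sub_iff_add_eq_add, e2, add_comm]
  -- multiply by `Q₂` on the left and use `Q₂·I = 1`
  have hd' : Q₂ * (Z₂.submatrix Sum.inl (Sum.inr ∘ Sum.inl) * (Q₁ - Q₂))
      = Q₂ * ((Z₂.submatrix Sum.inl (Sum.inr ∘ Sum.inr) - Z₁.submatrix Sum.inl (Sum.inr ∘ Sum.inr)) * P) := by rw [hd]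
  rw [← Matrix.mul_assoc, hQI, Matrix.one_mul, ← Matrix.mul_assoc] at hd'
  rw [← sub_eq_iff_eq_add', hd']

/-- [folklore] **THE CONVERSE IN v10's SHAPE, NO DETERMINANT CONDITION**: if `kkt H [Qᵢ;P]·Zᵢ = 1` (i = 1,2) and both legs display the SAME `fromBlocks Γ I L S'`, then
`∃ Y, Q₁ = Q₂ + Y·P`. -/
theorem rows_eq_add_mul_of_leg_eq' (H : Matrix ν ν ℝ) (Q₁ Q₂ : Matrix κ ν ℝ) (P : Matrix ρ ν ℝ)
    (Z₁ Z₂ : Matrix (ν ⊕ (κ ⊕ ρ)) (ν ⊕ (κ ⊕ ρ)) ℝ) (hZ₁ : kkt H (fromRows Q₁ P) * Z₁ = 1) (hZ₂ : kkt H (fromRows Q₂ P) * Z₂ = 1)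
    {Γ : Matrix ν ν ℝ} {I : Matrix ν κ ℝ} {L : Matrix κ ν ℝ} {S' : Matrix κ κ ℝ}
    (hL₁ : Z₁.submatrix (Sum.map id Sum.inl) (Sum.map id Sum.inl) = fromBlocks Γ I L S')
    (hL₂ : Z₂.submatrix (Sum.map id Sum.inl) (Sum.map id Sum.inl) = fromBlocks Γ I L S') :
    ∃ Y : Matrix κ ρ ℝ, Q₁ = Q₂ + Y * P := by
  have h11₁ : (Z₁.submatrix (Sum.map id Sum.inl) (Sum.map id Sum.inl)).toBlocks₁₁ = Z₁.submatrix Sum.inl Sum.inl := by ext i j; rfl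
  have h11₂ : (Z₂.submatrix (Sum.map id Sum.inl) (Sum.map id Sum.inl)).toBlocks₁₁ = Z₂.submatrix Sum.inl Sum.inl := by ext i j; rfl
  rw [hL₁, toBlocks_fromBlocks₁₁] at h11₁
  rw [hL₂, toBlocks_fromBlocks₁₁] at h11₂
  have h12₁ := leg_toBlocks₁₂ Z₁; rw [hL₁, toBlocks_fromBlocks₁₂] at h12₁
  have h12₂ := leg_toBlocks₁₂ Z₂; rw [hL₂, toBlocks_fromBlocks₁₂] at h12₂
  exact ⟨_, rows_eq_add_mul_of_shared_ff_fs H Q₁ Q₂ P Z₁ Z₂ hZ₁ hZ₂ (h11₁.symm.trans h11₂) (h12₁.symm.trans h12₂)⟩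

end Summit.QuantumFields.BalabanUV.Beta.FP.KktCombRowShearConverse

end
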